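import Literature.NumberTheory.AdelicBaseChange.CompletionBaseChange                      -- ★ FLT-port AKLB frame: `Extension`, `Extension.fintype`, `Ideal.sum_ramification_inertia_extensions`, `ramificationIdx_mul_inertiaDeg_eq_finrank`
import Summits.HodgeConjecture.HodgeConjecture.Theorems.R90S3CompletionOfDenseEmbedding      -- ★ P1 (K2E4-p14): `valued_apply_eq_valuation` (a dense embedding pins a place and its valuation)
import HarnessLib

/-!
# R90-TF · S3 · THEOREMS — `R90S3PlacesOverPlantedPrime` ((U3-F) split, brick P9′): the places of `F′` over `v` are EXHAUSTED by any family whose local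
# degrees `e·f = [F′_w : F₀_v]` add up to `[F′ : F₀]`, and places pinned by dense embeddings are DISTINCT as soon as the pulled-back valuations differ

R90-TF section S3 (successor dealer R90-C12-plan (g2), deal 2026-09-05T00:51:08Z «P9′ → K2E3-p21»; memo `R90/R90-C12-plan/g2/DEAL-S3-U3F-SPLIT` v2 row P9′;
census R90 bus 00:55:25Z); crux H413 (`stmt-HodgeConjecture-24833`, lane `--supports … --as helper`), route `HCCMUnconditional`.  Serves the assembly P8 of the
(U3-F) socket `stub_R90_S3_auxGlobaliseField` (`Cruxes/H413/Lines/R90_S3_LocalTransportWaveG.lean` :645): in the planted road `F′ = ℚ(α)`, `f = g̃ · ∏ᵢ (X − cᵢ)` over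
`ℚ_p`, the dense embeddings `α ↦ β ∈ K` and `α ↦ cᵢ ∈ ℚ_p` pin (★ P1) places of `F′` over `p` with `Σ e f = d₀ + r = [F′ : ℚ]`; this file turns that into «these are
ALL the places of `F′` over `p`» and supplies the distinctness of the pinned places.  THEOREMS ONLY (no `def`, no `instance`, no notation, no named fact, no
`sorry`); ★ imports only; never imports `Cruxes/…/Lines`.

CURRENCY (census): the FLT-port AKLB frame of ★ `Literature/NumberTheory/AdelicBaseChange/CompletionBaseChange.lean` at `A := 𝓞 F₀`, `K := F₀`, `L := F`, `B := 𝓞 F`: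
places over `v : HeightOneSpectrum (𝓞 F₀)` are `w : v.Extension (𝓞 F)` (`= {w // w.under (𝓞 F₀) = v}`, the same subtype as `UnitaryGroup.PlacesOver F v`), finite by
`HeightOneSpectrum.Extension.fintype (𝓞 F₀) F₀ F (𝓞 F) v`; `e`, `f` in Mathlib's dot form `w.1.asIdeal.ramificationIdx (𝓞 F₀)`, `w.1.asIdeal.inertiaDeg (𝓞 F₀)`;
for the base `ℚ`: `v := (Rat.HeightOneSpectrum.primesEquiv (R := 𝓞 ℚ)).symm ⟨p, hp⟩`, `ℚ_[p] ≃ v.adicCompletion ℚ` = ★ `Padic.adicCompletionEquiv`.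

THE MATHEMATICS [CasselsFrohlichANT1967 Ch. II §10 (10.2)–(10.3); NeukirchANT1999 Ch. II (8.2), (8.5); Serre1979 Ch. II §3].
(§1) EXHAUSTION BY DEGREE COUNT: `Σ_{w ∣ v} e(w|v) f(w|v) = [F : F₀]` (★ `Ideal.sum_ramification_inertia_extensions`) with every term `≥ 1` (Mathlib `Ideal.ramificationIdx_pos`,
`Ideal.inertiaDeg_pos`); so a finite family `T` of places over `v` with `Σ_{w ∈ T} e f = [F : F₀]` — equivalently `Σ_{w ∈ T} [F_w : F₀_v] = [F : F₀]`, by ★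
`ramificationIdx_mul_inertiaDeg_eq_finrank` (`e f = [F_w : F₀_v]`) — contains EVERY place over `v` (`Finset.sum_lt_sum_of_subset`).
(§2) DISTINCTNESS OF PINNED PLACES: a dense embedding `J : F →+* L_w` pins the place `w′ = {x ∈ 𝓞 F | v(J x) < 1}` with `v(J x) = v_{w′}(x)` for all `x ∈ F` (★ P1
`valued_apply_eq_valuation`); hence two dense embeddings whose pulled-back valuations differ at ONE `x ∈ F` pin DIFFERENT places.  For two embeddings into the SAME
completion `F₀_v` that are compatible with `F₀` and differ at some `α`, such an `x` is `α − a` with `a ∈ F₀` closer to `J₁ α` than `J₂ α` is (`F₀` is dense in `F₀_v`,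
Mathlib `denseRange_algebraMap`; ultrametric inequality): `|J₁ α − a| < |J₁ α − J₂ α| = |J₂ α − a|`.
* §1 **`forall_mem_of_sum_ramificationIdx_mul_inertiaDeg_eq_finrank`**, **`forall_mem_of_sum_finrank_adicCompletion_eq_finrank`**, `forall_exists_eq_of_sum_finrank_adicCompletion_eq_finrank`
  (every `W : HeightOneSpectrum (𝓞 F)` over `v` is `w.1` for some `w ∈ T`).
* §2 **`ne_of_valued_apply_ne`**, `valued_sub_ne_of_valued_sub_lt`, `exists_valued_sub_algebraMap_lt` (`|c − a| < |d|`), **`exists_valued_apply_ne_of_apply_ne`**;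
  §3 `exists_valued_apply_ne_of_apply_ne_rat` (base `ℚ`, compatibility automatic).

HONEST LABEL: HC_CM is proved only modulo the 7 printed citations (2 remaining named inputs: hLiu418 = stmt-HodgeConjecture-24832, h413 =
stmt-HodgeConjecture-24833) until rung 0 closes; infrastructure toward the GENUINE residual (U3-F); proves nothing printed; count-neutral.

## References
* [CasselsFrohlichANT1967] J. W. S. Cassels, A. Fröhlich (eds.), *Algebraic Number Theory* (1967), Ch. II §10 (10.2)–(10.3) (`Σ_w [L_w : K_v] = [L : K]`).
* [NeukirchANT1999] J. Neukirch, *Algebraic Number Theory* (1999), Ch. II (8.2) (`Σ e f = n`), (8.5).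
* [Serre1979] J.-P. Serre, *Local Fields*, GTM 67 (1979), Ch. II §3.
-/

set_option autoImplicit false
-- the mandated namespace repeats the single-problem summit's segment (`HodgeConjecture.HodgeConjecture`)
set_option linter.dupNamespace false

noncomputable section

namespace Summit.HodgeConjecture.HodgeConjecture.R90.S3

open NumberField IsDedekindDomain Finset

variable (F₀ F : Type) [Field F₀] [NumberField F₀] [Field F] [NumberField F] [Algebra F₀ F] (v : HeightOneSpectrum (𝓞 F₀))

/-! ## §1 Exhaustion of the places over `v` by degree count -/

/-- **EXHAUSTION BY `Σ e f`.**  If a finite family `T` of places of `F` over `v` already has `Σ_{w ∈ T} e(w|v) f(w|v) = [F : F₀]`, then `T` contains EVERY place of `F` over `v`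
(★ `Ideal.sum_ramification_inertia_extensions`: the full sum is `[F : F₀]`; every term is `≥ 1`, Mathlib `Ideal.ramificationIdx_pos`, `Ideal.inertiaDeg_pos`).
[cite: NeukirchANT1999, Ch. II (8.2)] [cite: CasselsFrohlichANT1967, Ch. II §10 (10.3)] -/
theorem forall_mem_of_sum_ramificationIdx_mul_inertiaDeg_eq_finrank (T : Finset (v.Extension (𝓞 F)))
    (hT : ∑ w ∈ T, w.1.asIdeal.ramificationIdx (𝓞 F₀) * w.1.asIdeal.inertiaDeg (𝓞 F₀) = Module.finrank F₀ F) :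
    ∀ w : v.Extension (𝓞 F), w ∈ T := by
  letI := HeightOneSpectrum.Extension.fintype (𝓞 F₀) F₀ F (𝓞 F) v
  haveI : Module.Finite F₀ F := Module.Finite.of_restrictScalars_finite ℚ F₀ F
  have hall : ∑ w : v.Extension (𝓞 F), w.1.asIdeal.ramificationIdx (𝓞 F₀) * w.1.asIdeal.inertiaDeg (𝓞 F₀) = Module.finrank F₀ F :=
    Ideal.sum_ramification_inertia_extensions (𝓞 F₀) F₀ F (𝓞 F) v
  intro w
  by_contra hw
  have hlt : ∑ w ∈ T, w.1.asIdeal.ramificationIdx (𝓞 F₀) * w.1.asIdeal.inertiaDeg (𝓞 F₀) <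
      ∑ w ∈ (univ : Finset (v.Extension (𝓞 F))), w.1.asIdeal.ramificationIdx (𝓞 F₀) * w.1.asIdeal.inertiaDeg (𝓞 F₀) :=
    sum_lt_sum_of_subset (subset_univ T) (mem_univ w) hw
      (Nat.mul_pos (Ideal.ramificationIdx_pos _ _) (Ideal.inertiaDeg_pos _ _)) (fun _ _ _ => Nat.zero_le _)
  rw [hT, hall] at hlt
  exact lt_irrefl _ hlt

/-- **EXHAUSTION BY LOCAL DEGREES `Σ [F_w : F₀_v]`** (the planted road's currency): if `Σ_{w ∈ T} [F_w : F₀_v] = [F : F₀]` then `T` contains every place of `F` over `v`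
(`e(w|v) f(w|v) = [F_w : F₀_v]`, ★ `ramificationIdx_mul_inertiaDeg_eq_finrank`). [cite: CasselsFrohlichANT1967, Ch. II §10 (10.2)–(10.3)] [cite: NeukirchANT1999, Ch. II (8.5)] -/
theorem forall_mem_of_sum_finrank_adicCompletion_eq_finrank (T : Finset (v.Extension (𝓞 F)))
    (hT : ∑ w ∈ T, Module.finrank (v.adicCompletion F₀) (w.1.adicCompletion F) = Module.finrank F₀ F) :
    ∀ w : v.Extension (𝓞 F), w ∈ T := by
  haveI : Module.Finite F₀ F := Module.Finite.of_restrictScalars_finite ℚ F₀ F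
  refine forall_mem_of_sum_ramificationIdx_mul_inertiaDeg_eq_finrank F₀ F v T ?_
  rw [← hT]
  exact sum_congr rfl fun w _ => HeightOneSpectrum.adicCompletion.ramificationIdx_mul_inertiaDeg_eq_finrank F₀ F w

/-- `HeightOneSpectrum` spelling of the exhaustion: every finite place `W` of `F` with `W ∩ 𝓞 F₀ = v` is (the underlying place of) a member of `T`.
[cite: NeukirchANT1999, Ch. II (8.2)] -/
theorem forall_exists_eq_of_sum_finrank_adicCompletion_eq_finrank (T : Finset (v.Extension (𝓞 F)))
    (hT : ∑ w ∈ T, Module.finrank (v.adicCompletion F₀) (w.1.adicCompletion F) = Module.finrank F₀ F)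
    (W : HeightOneSpectrum (𝓞 F)) (hW : W.under (𝓞 F₀) = v) : ∃ w ∈ T, w.1 = W :=
  ⟨⟨W, hW⟩, forall_mem_of_sum_finrank_adicCompletion_eq_finrank F₀ F v T hT ⟨W, hW⟩, rfl⟩

/-! ## §2 Places pinned by dense embeddings are distinct when the pulled-back valuations differ -/

/-- **DISTINCT PINNED PLACES.**  Two dense embeddings `J₁ : F →+* (L₁)_{w₁}`, `J₂ : F →+* (L₂)_{w₂}` pin places `w₁′, w₂′` of `F` (★ P1: `x ∈ wᵢ′ ⟺ v(Jᵢ x) < 1`, and then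
`v(Jᵢ x) = v_{wᵢ′}(x)` on `F`); if `v(J₁ x) ≠ v(J₂ x)` for ONE `x ∈ F`, then `w₁′ ≠ w₂′`. [cite: Serre1979, Ch. II §3] [cite: NeukirchANT1999, Ch. II (8.1)] -/
theorem ne_of_valued_apply_ne {L₁ L₂ : Type} [Field L₁] [NumberField L₁] [Field L₂] [NumberField L₂]
    (w₁ : HeightOneSpectrum (𝓞 L₁)) (w₂ : HeightOneSpectrum (𝓞 L₂)) (J₁ : F →+* w₁.adicCompletion L₁) (J₂ : F →+* w₂.adicCompletion L₂)
    (hJ₁ : DenseRange J₁) (hJ₂ : DenseRange J₂) {w₁' w₂' : HeightOneSpectrum (𝓞 F)}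
    (hw₁' : ∀ x : 𝓞 F, x ∈ w₁'.asIdeal ↔ Valued.v (J₁ (x : F)) < 1) (hw₂' : ∀ x : 𝓞 F, x ∈ w₂'.asIdeal ↔ Valued.v (J₂ (x : F)) < 1)
    (x : F) (hx : Valued.v (J₁ x) ≠ Valued.v (J₂ x)) : w₁' ≠ w₂' := by
  rintro rfl
  exact hx (by rw [valued_apply_eq_valuation w₁ J₁ hJ₁ hw₁' x, valued_apply_eq_valuation w₂ J₂ hJ₂ hw₂' x])

omit [NumberField F₀] [NumberField F] [Algebra F₀ F] in
/-- **Ultrametric witness**: if `c₁ ≠ c₂` and `a` is closer to `c₁` than `c₂` is (`|c₁ − a| < |c₁ − c₂|`), then `|c₁ − a| ≠ |c₂ − a|` (indeed `|c₂ − a| = |c₁ − c₂|`).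
[cite: Serre1979, Ch. II §1] -/
theorem valued_sub_ne_of_valued_sub_lt {K : Type} [Field K] [Valued K (WithZero (Multiplicative ℤ))] {c₁ c₂ a : K}
    (ha : Valued.v (c₁ - a) < Valued.v (c₁ - c₂)) : Valued.v (c₁ - a) ≠ Valued.v (c₂ - a) := by
  have h2 : Valued.v (c₂ - a) = Valued.v (c₁ - c₂) := by
    have hsum : c₂ - a = -((c₁ - c₂) - (c₁ - a)) := by ring
    rw [hsum, Valuation.map_neg, Valuation.map_sub_eq_of_lt_left _ ha]
  rw [h2]
  exact ha.ne

omit [NumberField F] [Algebra F₀ F] in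
/-- **`F₀` is dense in `F₀_v`**: for `c ∈ F₀_v` and `d ≠ 0` there is `a ∈ F₀` with `|c − a|_v < |d|_v` (Mathlib `HeightOneSpectrum.denseRange_algebraMap`, `Valued.mem_nhds`).
[cite: Serre1979, Ch. II §1] -/
theorem exists_valued_sub_algebraMap_lt (c : v.adicCompletion F₀) {d : v.adicCompletion F₀} (hd : d ≠ 0) :
    ∃ a : F₀, Valued.v (c - algebraMap F₀ (v.adicCompletion F₀) a) < Valued.v d := by
  have hc : c ∈ closure (Set.range (algebraMap F₀ (v.adicCompletion F₀))) := by
    rw [(HeightOneSpectrum.denseRange_algebraMap F₀ v).closure_range]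
    exact Set.mem_univ _
  rw [mem_closure_iff_nhds] at hc
  have hd' : (Valued.v : Valuation (v.adicCompletion F₀) (WithZero (Multiplicative ℤ))).restrict d ≠ 0 := by
    rw [Ne, Valuation.restrict_eq_zero_iff]
    exact (Valuation.ne_zero_iff _).2 hd
  have hnhds : {y : v.adicCompletion F₀ |
      (Valued.v : Valuation (v.adicCompletion F₀) (WithZero (Multiplicative ℤ))).restrict (y - c) <
        (Valued.v : Valuation (v.adicCompletion F₀) (WithZero (Multiplicative ℤ))).restrict d} ∈ nhds c :=
    Valued.mem_nhds.2 ⟨Units.mk0 _ hd', fun y hy => by simpa only [Units.val_mk0] using hy⟩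
  obtain ⟨y, hy, ⟨a, rfl⟩⟩ := hc _ hnhds
  refine ⟨a, ?_⟩
  have hy' : Valued.v (algebraMap F₀ (v.adicCompletion F₀) a - c) < Valued.v d := (Valuation.restrict_lt_iff _).1 hy
  rwa [← Valuation.map_neg, neg_sub] at hy'

/-- **Two embeddings into the SAME completion `F₀_v`, compatible with `F₀` and differing at `α`, have different pulled-back valuations at some `x ∈ F`** (`x = α − a`,
`a ∈ F₀` with `|J₁ α − a| < |J₁ α − J₂ α|`), hence (by `ne_of_valued_apply_ne`) pin different places. [cite: Serre1979, Ch. II §3] [cite: NeukirchANT1999, Ch. II (8.1)] -/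
theorem exists_valued_apply_ne_of_apply_ne (J₁ J₂ : F →+* v.adicCompletion F₀)
    (hJ₁ : ∀ a : F₀, J₁ (algebraMap F₀ F a) = algebraMap F₀ (v.adicCompletion F₀) a)
    (hJ₂ : ∀ a : F₀, J₂ (algebraMap F₀ F a) = algebraMap F₀ (v.adicCompletion F₀) a)
    (α : F) (h : J₁ α ≠ J₂ α) : ∃ x : F, Valued.v (J₁ x) ≠ Valued.v (J₂ x) := by
  obtain ⟨a, ha⟩ := exists_valued_sub_algebraMap_lt F₀ v (J₁ α) (sub_ne_zero.2 h)
  refine ⟨α - algebraMap F₀ F a, ?_⟩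
  rw [map_sub J₁, map_sub J₂, hJ₁, hJ₂]
  exact valued_sub_ne_of_valued_sub_lt ha

/-! ## §3 Base field `ℚ`: ring homomorphisms are automatically `ℚ`-compatible -/

/-- **Over `ℚ`** (the planted road: `F = ℚ(α)`, `Jᵢ : α ↦ cᵢ ∈ ℚ_p = v.adicCompletion ℚ`, `v = (Rat.HeightOneSpectrum.primesEquiv (R := 𝓞 ℚ)).symm ⟨p, hp⟩`): two embeddings
`J₁ J₂ : F →+* ℚ_v` with `J₁ α ≠ J₂ α` have different pulled-back valuations at some `x ∈ F` (compatibility with `ℚ` is automatic, Mathlib `map_ratCast`), hence pin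
different places by `ne_of_valued_apply_ne`. [cite: Serre1979, Ch. II §3] -/
theorem exists_valued_apply_ne_of_apply_ne_rat (v : HeightOneSpectrum (𝓞 ℚ)) (J₁ J₂ : F →+* v.adicCompletion ℚ) (α : F) (h : J₁ α ≠ J₂ α) :
    ∃ x : F, Valued.v (J₁ x) ≠ Valued.v (J₂ x) :=
  exists_valued_apply_ne_of_apply_ne ℚ F v J₁ J₂ (fun a => by rw [eq_ratCast, map_ratCast, eq_ratCast])
    (fun a => by rw [eq_ratCast, map_ratCast, eq_ratCast]) α h

end Summit.HodgeConjecture.HodgeConjecture.R90.S3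

end
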